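/-
Copyright (c) 2026 the pub-hodgecm-mathlib formalisation cell (harness21).  Prover seat hodgecm-mathlib-LH7-p09 (g2), CLOSE-OUT ROSTER strike line L3∕L5 (Track A
«(D-RAM) FOUR-FRAME» squad F0∕P3c∕LH4 ∕ F0∕P3c∕LH7); β₂-BOARD v2 row (OFF) (lead LH7-p09 (g2); β₂ WORD #22: the `hL_mix` assembly by the ω-flip — the EXISTENCE input);
helper lane on h413 = stmt-HodgeConjecture-24833 (count-neutral).  2026-09-05.
-/
import Summits.HodgeConjecture.HodgeConjecture.Theorems.F0P3cDyRamConeCellFaceTube               -- ★ (LH4-p16 (g0)): HEAD-lo-ω frame; brings ★ `exists_coneData_of_gen`, ★ T1 `natCard_normFibre_eq_pow_of_succ_le`, ★ DEFS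
import Literature.NumberTheory.Automorphic.UnitaryLatticeTreeBlockGlueFibreCountPlane              -- ★ Lit: `ncard_glueFibre_map_planeMatrix_eq_natCard_normFibre`, `dualLatt_sup_span_eq_iff_forall_mem_iff`
import HarnessLib

/-!
# Crux `H413`, line LH4 «(D-RAM) FOUR-FRAME» — the (β₂) road (R-36), β₂-BOARD v2 row (OFF), socket `hL_mix` (β₂ WORD #22): «BELOW THE GLUE CONDUCTOR EVERY TUBE-CELL MEMBER
# CARRIES A GLUED SELF-DUAL VERTEX» — for `Λ ∈ levelSetDep(j, b; lam − jE u)` with `1 ≤ b`, `b + 1 ≤ d` there are `B` with `φ(B) = Λ` and a self-dual `L₃` with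
# `L₃ ∩ W = ι_W B` and tube coordinate `b` — the existence input of the ω-flip face (★ `…LowerLineLabelFlip`) for the (OFF) socket `hL_mix`

Cell `hodgecm-mathlib` (D-0151), FLOOR 0, crux item H413 = `stmt-HodgeConjecture-24833`, route of record `HCCMUnconditional`; squads F0∕P3c∕LH4 ∕ LH7; lane
`--supports stmt-HodgeConjecture-24833 --as helper` (count-neutral; pays NO tier-0 row).  THEOREMS ONLY (no `def`, no instance, no notation, no `sorry`, default heartbeats);
★-only imports; states NO law; (β₂) stays a HYPOTHESIS.  Frame = ★ `…ConeCellFaceTube.weight_eq_pow_of_mem_levelSetDep_of_succ_le`'s (E-side wild datum of ★ T1, block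
`(H₂, h_W)` with `H₂` hermitian of unit determinant, ★ (C1)'s line model).

WHY.  ★ `…ConeCellFaceTube.finsum_levelSetDep_inter_weight_eq_of_omegaFace_exchange_of_succ_le` balances the weighted labelled counts of a tube cell below the conductor GIVEN
`hface`; ★ `…LowerLineLabelFlip.valueSet_flip_of_line_sizes` proves the label reversal for a PAIR of glued vertices over `Λ` and `ε·Λ`; what `hface` still needs is that a glued
vertex EXISTS over every member of the cell.  It does: by ★ `exists_coneData_of_gen` a member `Λ = x₀·𝒪_j` of `levelSetDep(j, b; μ)` has canonical plane data `(B = g·𝒪², w₀)` with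
the gluing token `(B ⊔ 𝒪w₀)^♯ = B` (★ Lit `dualLatt_sup_span_eq_iff_forall_mem_iff`) and `|⟨w₀, w₀⟩|·|ϖ|^{2b} = 1`; ★ Lit `ncard_glueFibre_map_planeMatrix_eq_natCard_normFibre` counts
the self-dual `L₃` with `L₃ ∩ W = ι_W B` and tube `b` by `#Sol_{2b}(r)`, `r = −⟨w₀, w₀⟩·ϖ^bσ(ϖ^b)∕h_W` a `σ`-fixed unit; ★ T1 `natCard_normFibre_eq_pow_of_succ_le` makes that `q^b ≠ 0`
below the conductor; so the fibre is non-empty.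
* HEAD `exists_glued_of_mem_levelSetDep_of_succ_le` — `∃ B, φ(B) = Λ ∧ ∃ L₃, IsSelfDualLattice σ ϖ (block H₂ h_W) L₃ ∧ L₃ ⊓ ker pr₁ = B.map ι ∧ (∀ c, c·e₁ ∈ L₃ ↔ |c| ≤ |ϖ|^b)`
  — the three conjuncts of the (OFF) literals' inner set, BYTE-SHAPED as in ★ p863399 ∕ LH4-p12 (g8)'s ED. 6.
HONEST LABEL.  Count-neutral lattice bookkeeping; nothing printed is asserted; no census law is stated; `hL_mix` stays OPEN (assembly next); `HC_CM` is proved only modulo the 7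
printed citations (2 remaining named inputs: hLiu418 = `stmt-HodgeConjecture-24832`, h413 = `stmt-HodgeConjecture-24833`) until rung 0 closes.
## References
* [Jacobowitz1962] R. Jacobowitz, *Hermitian forms over local fields*, Amer. J. Math. 84 (1962): §4 (duals, modular components, gluing).
* [BruhatTits1972] F. Bruhat, J. Tits, *Groupes réductifs sur un corps local I*, Publ. Math. IHÉS 41 (1972): §10.
* [Serre1979] J.-P. Serre, *Local Fields*, GTM 67 (1979): Ch. V §3 Prop. 5, Cor. 2–3 (norm residues below the conductor).
* [Kottwitz1986BaseChangeUnits] R. E. Kottwitz, *Base change for unit elements of Hecke algebras*, Compositio Math. 60 (1986): §1 pp. 240–241.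
-/

set_option autoImplicit false

noncomputable section

open scoped Pointwise Valued WithZero Matrix MatrixGroups
open WithZero
open scoped Classical
open Literature.NumberTheory.Automorphic Literature.NumberTheory.Automorphic.HermitianLattice Literature.NumberTheory.Automorphic.UnitaryLatticeTree
open Literature.NumberTheory.Automorphic.UnitaryThreeFourFrame (IsRamifiedQuadraticDatum)
open Literature.NumberTheory.Automorphic.EllipticPlaneAsFieldLine
open Literature.NumberTheory.LocalFields.QuadraticOrder
open Literature.NumberTheory.LocalFields.WildQuadraticDatum
open Summit.HodgeConjecture.HodgeConjecture.Cruxes.H413.F0P3cDyRamToricCensusDefs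
open Summit.HodgeConjecture.HodgeConjecture.Cruxes.H413.F0P3cDyRamConeLevelTransport
open Summit.HodgeConjecture.HodgeConjecture.Cruxes.H413.F0P3cDyRamConeWeightHalfSplit

namespace Summit.HodgeConjecture.HodgeConjecture.Cruxes.H413.F0P3cDyRamTubeCellGluedVertexExists

variable {E : Type} {M : Type*} [Field E] [Valued E ℤᵐ⁰] [Field M] [Valued M ℤᵐ⁰] {ρ Θ : M →+* M} {α : M}

/-- **HEAD — «BELOW THE GLUE CONDUCTOR EVERY TUBE-CELL MEMBER CARRIES A GLUED SELF-DUAL VERTEX».**  Frame of ★ `…ConeCellFaceTube.weight_eq_pow_of_mem_levelSetDep_of_succ_le`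
(E-side wild datum `IsRamifiedQuadraticDatum σ ϖ d t`, `|2| < 1`, finite residue field; block `(H₂, h_W)` with `H₂` hermitian of UNIT determinant, `|h_W| = 1`, `σh_W = h_W`; ★ (C1)'s
line model; cell `(j, b)` with `1 ≤ b`, `b + 1 ≤ d`, `lam ∈ 𝒪_j`).  THEN every `Λ ∈ levelSetDep(j, b; lam − jE u)` has plane data `B` with `φ(B) = Λ` and a glued vertex: a self-dual
`L₃` for the block form with `L₃ ∩ W = ι_W B` and tube coordinate `b`. [cite: Jacobowitz1962, §4] [cite: BruhatTits1972, §10] [cite: Serre1979, Ch. V §3 Cor. 3] [cite: Kottwitz1986BaseChangeUnits, §1 pp. 240–241] -/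
theorem exists_glued_of_mem_levelSetDep_of_succ_le [IsDiscreteValuationRing 𝒪[E]] [Finite 𝓀[E]]
    (σ : E →+* E) (hσ : ∀ a, σ (σ a) = a) (hvσ : ∀ a, Valued.v (σ a) = Valued.v a)
    {ϖ : E} (hϖ : Valued.v ϖ = WithZero.exp (-1 : ℤ)) {d t : ℕ} (hD : IsRamifiedQuadraticDatum σ ϖ d t) (h2v : Valued.v (2 : E) < 1)
    {H₂ : Matrix (Fin 2) (Fin 2) E} (hH₂ : IsUnit H₂.det) (hH₂σ : (H₂.map σ)ᵀ = H₂) {hW : E} (hhW : Valued.v hW = 1) (hhWσ : σ hW = hW) (jE : E →+* M)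
    (hρρ : ∀ x, ρ (ρ x) = x) (hvρ : ∀ x, Valued.v (ρ x) = Valued.v x) (hα : ρ α ≠ α) (hα1 : Valued.v α ≤ 1)
    (hint : ∀ z : M, Valued.v z ≤ 1 → Valued.v ((z - ρ z) / (α - ρ α)) ≤ 1)
    (hΘΘ : ∀ x, Θ (Θ x) = x) (hΘρ : ∀ x, Θ (ρ x) = ρ (Θ x)) (hvΘ : ∀ x, Valued.v (Θ x) = Valued.v x)
    (hjv : ∀ c, Valued.v (jE c) ≤ 1 ↔ Valued.v c ≤ 1) (hjfix : ∀ z, ρ z = z ↔ ∃ c, jE c = z)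
    (hjpow : ∀ (t : E) (n : ℤ), Valued.v (jE t) = Valued.v (jE ϖ) ^ n ↔ Valued.v t = Valued.v ϖ ^ n)
    (hϖmax : ∀ t : M, ρ t = t → Valued.v t < 1 → Valued.v t ≤ Valued.v (jE ϖ))
    (φ : (Fin 2 → E) →+ M) (hφs : ∀ (c : E) (x : Fin 2 → E), φ (c • x) = jE c * φ x) (hφi : Function.Injective φ) (hφo : Function.Surjective φ)
    {γ₂ : GL (Fin 2) E} {lam h : M} (hφγ : ∀ x, φ ((γ₂ : Matrix (Fin 2) (Fin 2) E).mulVec x) = lam * φ x) (hlam : Valued.v lam = 1)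
    (hΘh : Θ h = h) (hh : h ≠ 0) (hform : ∀ x y, jE (pairing σ H₂ x y) = h * Θ (φ x) * φ y + ρ (h * Θ (φ x) * φ y))
    (u : E) {b : ℕ} (hb : 1 ≤ b) (hbd : b + 1 ≤ d) {j : ℕ} (hlamj : IsOrd ρ α (jE ϖ ^ j) lam)
    {Λ : AddSubgroup M} (hΛ : Λ ∈ levelSetDep ρ Θ α (jE ϖ) h j b (lam - jE u)) :
    ∃ B : Submodule 𝒪[E] (Fin 2 → E), B.toAddSubgroup.map φ = Λ ∧
      ∃ L₃ : Submodule 𝒪[E] (Fin 3 → E), IsSelfDualLattice σ ϖ (!![H₂ 0 0, 0, H₂ 0 1; 0, hW, 0; H₂ 1 0, 0, H₂ 1 1] : Matrix (Fin 3) (Fin 3) E) L₃ ∧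
        L₃ ⊓ LinearMap.ker ((LinearMap.proj (1 : Fin 3) : (Fin 3 → E) →ₗ[E] E).restrictScalars 𝒪[E]) =
          B.map ((Matrix.toLin' (!![1, 0; 0, 0; 0, 1] : Matrix (Fin 3) (Fin 2) E)).restrictScalars 𝒪[E]) ∧
        (∀ c : E, (Pi.single 1 c : Fin 3 → E) ∈ L₃ ↔ Valued.v c ≤ Valued.v ϖ ^ b) := by
  have hvϖ0 : Valued.v ϖ ≠ 0 := by rw [hϖ]; exact WithZero.exp_ne_zero
  have hϖ0 : ϖ ≠ 0 := fun h0 => by rw [h0, map_zero] at hvϖ0; exact hvϖ0 rfl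
  have hϖ1 : Valued.v ϖ < 1 := by rw [hϖ, ← WithZero.exp_zero, WithZero.exp_lt_exp]; norm_num
  have hH : ∀ a b', σ (H₂ a b') = H₂ b' a := by
    intro a b'
    have := congrFun (congrFun hH₂σ b') a
    simpa [Matrix.transpose_apply, Matrix.map_apply] using this
  obtain ⟨⟨x₀, hx₀, hΛx, hyO, hyprim, hylev⟩, hdepΛ⟩ := hΛ
  -- the canonical cone data of the member: a full plane lattice `B = g·𝒪²` with `φ(B) = Λ`, and `w₀` with the two plane tokens
  obtain ⟨B, hBΛ, ⟨g, hBg⟩, -, w₀, -, hG1, -, hw₀, -⟩ := exists_coneData_of_gen σ hϖ0 hϖ1 H₂ jE hρρ hvρ hα hα1 hint hΘΘ hΘρ hvΘ hjv hjfix hjpow hϖmax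
    φ hφs hφi hφo hφγ hlam hΘh hh hform u hb hx₀ hΛx hyO hyprim hylev hdepΛ hlamj
  have hG1' : dualLatt σ H₂ (B ⊔ Submodule.span 𝒪[E] {w₀}) = B := (dualLatt_sup_span_eq_iff_forall_mem_iff hvσ H₂ B w₀).2 hG1
  -- the glue fibre over `(B, b)` is counted by `#Sol_{2b}(r)`, `r` a `σ`-fixed unit
  have hcount := ncard_glueFibre_map_planeMatrix_eq_natCard_normFibre σ hσ hvσ hϖ hH₂ hH₂σ hhW hhWσ g hBg hb hG1' hw₀
  set r₀ : E := -(pairing σ H₂ w₀ w₀) * (ϖ ^ b * σ (ϖ ^ b)) / hW with hr₀def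
  have hpair₀ : σ (pairing σ H₂ w₀ w₀) = pairing σ H₂ w₀ w₀ := (pairing_comm_of_hermitian hσ hH w₀ w₀).symm
  have hσr₀ : σ r₀ = r₀ := by
    rw [hr₀def, map_div₀, map_mul, map_neg, hpair₀, map_mul, hσ, hhWσ, mul_comm (σ (ϖ ^ b)) (ϖ ^ b)]
  have hr₀1 : Valued.v r₀ = 1 := by
    rw [hr₀def, map_div₀, map_mul, Valuation.map_neg, map_mul, hvσ, map_pow, hhW, div_one, ← pow_add, ← two_mul]
    exact hw₀
  -- below the conductor `#Sol_{2b}(r) = q^b ≠ 0`, so the fibre is non-empty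
  have hne : {L₃ : Submodule 𝒪[E] (Fin 3 → E) | IsSelfDualLattice σ ϖ (!![H₂ 0 0, 0, H₂ 0 1; 0, hW, 0; H₂ 1 0, 0, H₂ 1 1] : Matrix (Fin 3) (Fin 3) E) L₃ ∧
        L₃ ⊓ LinearMap.ker ((LinearMap.proj (1 : Fin 3) : (Fin 3 → E) →ₗ[E] E).restrictScalars 𝒪[E]) =
          B.map ((Matrix.toLin' (!![1, 0; 0, 0; 0, 1] : Matrix (Fin 3) (Fin 2) E)).restrictScalars 𝒪[E]) ∧
        ∀ c : E, (Pi.single 1 c : Fin 3 → E) ∈ L₃ ↔ Valued.v c ≤ Valued.v ϖ ^ b}.ncard ≠ 0 := by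
    rw [hcount, natCard_normFibre_eq_pow_of_succ_le hD h2v hσr₀ hr₀1 hb hbd]
    exact pow_ne_zero _ (Nat.card_pos (α := 𝓀[E])).ne'
  obtain ⟨L₃, hL, hLB, htube⟩ := Set.nonempty_of_ncard_ne_zero hne
  exact ⟨B, hBΛ, L₃, hL, hLB, htube⟩

end Summit.HodgeConjecture.HodgeConjecture.Cruxes.H413.F0P3cDyRamTubeCellGluedVertexExists

end
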